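import Literature.NumberTheory.Automorphic.CDTTheorem712
import Literature.NumberTheory.EllipticCurves.ModFiveCongruenceHesseFamily
import Literature.NumberTheory.EllipticCurves.GlobalMinimalModel
import Literature.NumberTheory.EllipticCurves.Tamagawa
import Literature.NumberTheory.EllipticCurves.WeilPairingProofs
import Literature.NumberTheory.EllipticCurves.VariableChangePoints
import Literature.NumberTheory.EllipticCurves.TorsionFrobeniusChebotarevProofs
import Literature.NumberTheory.EllipticCurves.SupersingularDensitySerreTraceProofs
import Literature.NumberTheory.EllipticCurves.ModPIrreducibleCongruenceTransferProofs
import Literature.NumberTheory.GaloisRepresentations.QuarticTwistEulerFactors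
import HarnessLib

/-!
# stub-ideation k1 (GEN 4, FAMILY 1 — recognise & import) for `stub_switch` = `CDT_three_five_switch`

Companion of `STUB-IDEAS-stub_switch-1.md` (gen 4).  Extends (does not replace) the gen-3 companion
`STUB_IDEAS_stub_switch_1g3_Sketch.lean` (namespace `…StubSwitchK1G3`: objects `baseF/memberF/trace/
DirectCongrFive`, named facts N1 `DeuringOrdinaryExistence`, N2′ `Thm132iiPrimeField`, atom F2
`FrobeniusCertificate`, kernel-checked assembly `switch_of_deuringRoad`).

GEN-4 DELTA ("CM-anchor road"): the XL named fact N1 (Deuring–Waterhouse) is REPLACED, for every `W`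
outside one explicit mod-5 image class, by TREE-PROVED material:
* Chebotarev for division fields (`chebotarev_geomTorsion_holds`, PROVED) + `tr ρ̄(Frob_ℓ) = a_ℓ`,
  `det = ℓ` on `E[5]` (`trace/det_galoisRepTorsion_frobenius_eq`, PROVED) — the Frobenius SUPPLY;
* the `j = 1728` anchor `E_D : y² = x³ − Dx` and Ireland–Rosen 18 §4 Thm 5 (`a_ℓ(E_D) = ū π + u π̄`,
  tree `QuarticTwist.pow_three_mul_add_mul_galRestrict_eq`, PROVED): at a prime `ℓ ≡ 1 (4)` the four
  quartic twists realise EVERY split semisimple Frobenius class of determinant `ℓ` on `5`-torsion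
  (`μ₄ ↠` the anti-diagonal torus of `C_s(5)`), and at `ℓ ≡ 5 (12)` all of them have `3 ∤ a_ℓ`.
So: no curve with prescribed trace has to be CONSTRUCTED (Deuring); it is a TWIST of a fixed CM curve.
The statements below elaborate; `sorry` only in helper lemmas (B2–B6, C2–C3) and the two assemblies.
-/

set_option linter.dupNamespace false

namespace Summit.ABC.ABC.Cruxes.FreyModularity.StubSwitchK1G4

open Literature.NumberTheory.EllipticCurves Literature.NumberTheory.EllipticCurves.HesseFamilyFive
open Literature.NumberTheory.Automorphic Literature.NumberTheory.GaloisRepresentations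
open Literature.NumberTheory.Automorphic.BCDT WeierstrassCurve Field

noncomputable section

universe u

/-! ## §−1 Verbatim copies of the gen-3 companion's objects and atoms (`…StubSwitchK1G3`; the crux-dir
modules are not build targets, hence not importable — same names, same text) -/

/-- Fisher's base model `E : y² = x³ − 27c₄x − 54c₆`. [Fisher2012Hessian, Thm 13.2] (= G3 `baseF`) -/
abbrev baseF {F : Type u} [Field F] (c₄ c₆ : F) : WeierstrassCurve F := ⟨0, 0, 0, -27 * c₄, -54 * c₆⟩

/-- The Hesse member `E_{l,m}` (tree polynomials `HesseFamilyFive.C4/C6`). (= G3 `memberF`) -/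
abbrev memberF {F : Type u} [Field F] (c₄ c₆ l m : F) : WeierstrassCurve F :=
  ⟨0, 0, 0, -27 * C4 c₄ c₆ l m, -54 * C6 c₄ c₆ l m⟩

/-- `a = q + 1 − #V(𝔽_q)`. (= G3 `trace`) -/
def trace (q : ℕ) (V : WeierstrassCurve (ZMod q)) : ℤ := (q : ℤ) + 1 - Nat.card V.toAffine.Point

/-- Direct `5`-congruence over a field ([Fisher2012Hessian] Def. 13.1). (= G3 `DirectCongrFive`) -/
def DirectCongrFive {F : Type u} [Field F] (W₁ W₂ : WeierstrassCurve F) [W₁.IsElliptic] [W₂.IsElliptic]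
    (h5 : ((5 : ℕ) : F) ≠ 0) : Prop :=
  ∃ e : W₁.geomTorsion 5 ≃+ W₂.geomTorsion 5,
    (∀ (σ : absoluteGaloisGroup F) (P : W₁.geomTorsion 5), e (σ • P) = σ • e P) ∧
    ∀ P Q : W₁.geomTorsion 5,
      weilPairingFun h5 ((e P : W₂.geomTorsion 5) : W₂.geomPoints) ((e Q : W₂.geomTorsion 5) : W₂.geomPoints)
        = weilPairingFun h5 (P : W₁.geomPoints) (Q : W₁.geomPoints)

/-- N1 (gen 3, XL — the fact gen 4 REMOVES): Deuring 1941 / Waterhouse 1969 Thm 4.1. -/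
def DeuringOrdinaryExistence : Prop :=
  ∀ (p : ℕ) [Fact p.Prime] (t : ℤ), t ≠ 0 → t ^ 2 < 4 * (p : ℤ) →
    ∃ V : WeierstrassCurve (ZMod p), V.IsElliptic ∧ trace p V = t

/-- N2′ (gen 3, kept): Fisher 2012 Thm 13.2 (ii) over `𝔽_q`. [Fisher2012Hessian, Thm 13.2] -/
def Thm132iiPrimeField : Prop :=
  ∀ (q : ℕ) [Fact q.Prime], 7 ≤ q → ∀ (h5 : ((5 : ℕ) : ZMod q) ≠ 0)
    (E E' : WeierstrassCurve (ZMod q)) [E.IsElliptic] [E'.IsElliptic] (c₄ c₆ : ZMod q),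
    E = baseF c₄ c₆ → DirectCongrFive E E' h5 →
      ∃ (l m : ZMod q) (C : VariableChange (ZMod q)), C • E' = memberF c₄ c₆ l m

/-- F2 (gen 2/3, kept; S given the tree): the order-8 Frobenius certificate at a good `q ≡ 2 (3)`,
`3 ∤ a_q` ⇒ `ρ̄_{E,3}` abs. irreducible over `ℚ(√−3)` (`trace/det_galoisRepTorsion_frobenius_eq`,
`Theorems.isAbsIrreducibleOverSqrt_negThree_of_orderOf_eq_eight`, PROVED). -/
def FrobeniusCertificate : Prop :=
  ∀ (W : WeierstrassCurve ℚ) [W.IsElliptic] [W.IsGloballyMinimal] (q : ℕ) [Fact q.Prime],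
    q % 3 = 2 → W.HasGoodReductionAtPrime q → ¬ (3 : ℤ) ∣ W.frobeniusTrace q →
    ∀ ρ₃ : ModPGaloisRep ℚ (ZMod 3) 2, W.IsTorsionGaloisRep 3 ρ₃ → ρ₃.IsAbsIrreducibleOverSqrt (-3)

/-! ## §0 Objects: trace / determinant of `σ` on `W[5]`; the two CM anchors -/

/-- `tr ρ̄_{W,5}(σ) ∈ 𝔽₅` (the tree's incantation, `SupersingularDensitySerreTraceProofs`). -/
def tr5 (W : WeierstrassCurve ℚ) (σ : absoluteGaloisGroup ℚ) : ZMod 5 :=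
  haveI : Fact (Nat.Prime 5) := ⟨by norm_num⟩
  letI : Module (ZMod 5) (geomTorsion W 5) := AddSubgroup.torsionBy.zmodModule
  LinearMap.trace (ZMod 5) (geomTorsion W 5)
    ((galoisRepTorsion W 5 σ).toAdd.toAddMonoidHom.toZModLinearMap 5)

/-- `det ρ̄_{W,5}(σ) ∈ 𝔽₅` (`ModPIrreducibleCongruenceTransferProofs`). -/
def det5 (W : WeierstrassCurve ℚ) (σ : absoluteGaloisGroup ℚ) : ZMod 5 :=
  haveI : Fact (Nat.Prime 5) := ⟨by norm_num⟩
  letI : Module (ZMod 5) (geomTorsion W 5) := AddSubgroup.torsionBy.zmodModule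
  LinearMap.det ((galoisRepTorsion W 5 σ).toAdd.toAddMonoidHom.toZModLinearMap 5)

/-- The `j = 1728` anchor family `E_D : y² = x³ − D x` (CM by `ℤ[i]`; over `ℚ` = Cremona 32a2 twists;
the tree's `QuarticTwist` curve `⟨0, 0, 0, -D, 0⟩`). -/
abbrev anchorTwist {R : Type} [CommRing R] (D : R) : WeierstrassCurve R := ⟨0, 0, 0, -D, 0⟩

/-- The `j = −3375` anchor (Cremona 49a1 `[1,−1,0,−2,−1]`, CM by `𝓞_{ℚ(√−7)}`, `5` INERT in `ℚ(√−7)`,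
one of the tree's nine minimal CM models, `DeuringSupersingularReductionHoldsProofs` §2). -/
abbrev anchor49 {R : Type} [CommRing R] : WeierstrassCurve R := ⟨1, -1, 0, -2, -1⟩

/-! ## §1 Case predicates (pure statements about the image of `Γ_ℚ` on `W[5]`, `i`, `ζ₃`, `√−7`) -/

/-- **Case I witness ("split switch element").**  Some `σ ∈ Γ_ℚ` fixes `i`, inverts `ζ₃`, and acts on
`W[5]` with two DISTINCT eigenvalues in `𝔽₅`.  By the finite check `bc/sigma_exist_gl25.py` (all 466
subgroups of `GL₂(𝔽₅)`): under the stub's `hirr` this holds for every `W` EXCEPT when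
`ρ̄_{W,5}(Γ_ℚ) = N(C_ns(5))` with Cartan field `ℚ(i)` or `ℚ(√−5)` (class `X₅`). -/
def HasSplitSwitchElement (W : WeierstrassCurve ℚ) : Prop :=
  ∃ σ : absoluteGaloisGroup ℚ,
    (∀ ι : AlgebraicClosure ℚ, ι ^ 2 = -1 → σ • ι = ι) ∧
    (∀ ζ : AlgebraicClosure ℚ, ζ ^ 2 + ζ + 1 = 0 → σ • ζ = ζ ^ 2) ∧
    ∃ x y : ZMod 5, x ≠ y ∧ x * y = det5 W σ ∧ x + y = tr5 W σ

/-- **Case II′ witness ("non-split switch element", for the class `X₅`).**  Some `σ` inverts `ζ₃`, fixes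
`√−7`, acts on `W[5]` with IRREDUCIBLE characteristic polynomial, and has the same trace up to sign on
`anchor49[5]`.  Finite check `bc/goursat_planC.py`: holds throughout `X₅` (6 joint-image types, 0 fail). -/
def HasNonsplitSwitchElement (W : WeierstrassCurve ℚ) : Prop :=
  ∃ σ : absoluteGaloisGroup ℚ,
    (∀ ζ : AlgebraicClosure ℚ, ζ ^ 2 + ζ + 1 = 0 → σ • ζ = ζ ^ 2) ∧
    (∀ r : AlgebraicClosure ℚ, r ^ 2 = -7 → σ • r = r) ∧
    ¬ IsSquare (tr5 W σ ^ 2 - 4 * det5 W σ) ∧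
    (tr5 (anchor49 : WeierstrassCurve ℚ) σ = tr5 W σ ∨ tr5 (anchor49 : WeierstrassCurve ℚ) σ = -tr5 W σ)

/-! ## §2 The interface both roads feed: a "switch supply" at some auxiliary prime `ℓ` -/

/-- **Switch supply for `W` avoiding `S`.**  A prime `ℓ ∉ S`, `ℓ ≡ 2 (mod 3)`, of good reduction, at
which `ρ̄_{W,5}(Frob_ℓ)` is SEMISIMPLE REGULAR (`a_ℓ² − 4ℓ ≢ 0 mod 5`), together with an elliptic curve
`V/𝔽_ℓ` having `a(V) ≡ a_ℓ(W) (mod 5)` and `3 ∤ a(V)`.  Gen-3 produced this with `V` from Deuring's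
theorem (N1, XL); gen-4 produces it from a TWIST OF A CM ANCHOR (B3/C3, tree-provable). -/
def SwitchSupplyAt (W : WeierstrassCurve ℚ) [W.IsGloballyMinimal] (S : Finset ℕ) : Prop :=
  ∃ ℓ : ℕ, ℓ.Prime ∧ ℓ ∉ S ∧ ℓ % 3 = 2 ∧ ¬ (ℓ : ℤ) ∣ minimalDiscriminantInt W ∧
    (W.frobeniusTrace ℓ : ZMod 5) ^ 2 - 4 * (ℓ : ZMod 5) ≠ 0 ∧
    ∃ V : WeierstrassCurve (ZMod ℓ), V.IsElliptic ∧
      (trace ℓ V : ZMod 5) = (W.frobeniusTrace ℓ : ZMod 5) ∧ ¬ (3 : ℤ) ∣ trace ℓ V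

/-! ## §3 Helper lemmas of the CM-anchor road (each ≈ one prover cycle unless marked) -/

/-- **B2 (M) — Frobenius supply, split case.**  Chebotarev (`chebotarev_geomTorsion_holds`, PROVED —
applied to the permutation Artin representation on the finite `Γ_ℚ`-set `W[5] ⊔ {±i} ⊔ {ζ₃, ζ₃²}` built
exactly as in `TorsionFrobeniusProofs.exists_framedArtinRep_geomTorsion`, then `chebotarevArtinRep_holds`)
turns a Case-I `σ` into a good prime `ℓ ≡ 5 (mod 12)` outside any finite set whose Frobenius on `W[5]`
has the distinct rational eigenvalues `x ≠ y`: `a_ℓ ≡ x + y`, `ℓ ≡ xy (mod 5)` by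
`trace_galoisRepTorsion_frobenius_eq` / `det_galoisRepTorsion_frobenius_eq` (PROVED); `ℓ ≡ 1 (4)`,
`ℓ ≡ 2 (3)` from `IsArithFrobAt`: `φ i − i^ℓ ∈ 𝔓`, `φ ζ₃ − ζ₃^ℓ ∈ 𝔓` with `(2i)² = −4`,
`(ζ₃ − ζ₃²)² = −3` units at `𝔓` once `2, 3 ∈ S`.  Model proof:
`exists_goodPrime_frobeniusTrace_det_eq_of_hasSurjectiveModNGaloisRep` (same file family, PROVED). -/
theorem frobeniusSupply_split (W : WeierstrassCurve ℚ) [W.IsElliptic] [W.IsGloballyMinimal]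
    (hW : HasSplitSwitchElement W) (S : Finset ℕ) :
    ∃ ℓ : ℕ, ℓ.Prime ∧ ℓ ∉ S ∧ ℓ % 12 = 5 ∧ ¬ (ℓ : ℤ) ∣ minimalDiscriminantInt W ∧
      ∃ x y : ZMod 5, x ≠ y ∧ x * y = (ℓ : ZMod 5) ∧ x + y = (W.frobeniusTrace ℓ : ZMod 5) := by
  sorry

/-- **B3 (M) — the quartic twists of `y² = x³ − x` realise every split trace.**  For a prime `ℓ ≡ 1 (4)`,
`ℓ ≠ 5`, and `x, y ∈ 𝔽₅` with `xy = ℓ`, some `D ∈ 𝔽_ℓ^×` has `E_D` elliptic with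
`a_ℓ(E_D) ≡ x + y (mod 5)`.  From the tree's PROVED Ireland–Rosen 18 §4 Thm 5
(`QuarticTwist.pow_three_mul_add_mul_galRestrict_eq`: `a_ℓ(E_D) = χ_π(D)³·π + conj`, `π = a + bi`
primary, `ℓ = a² + b²`, `χ_π` the quartic symbol ONTO `μ₄`): the four twists have traces `±2a, ±2b`, and
`{±2a, ±2b} = {u + ℓ/u : u ∈ 𝔽₅^×}` because `[i] ↦ diag(2, 3)` and `3` generates `𝔽₅^×` (so `μ₄·π̄`
sweeps the whole diagonal torus of determinant `ℓ`).  Affine count ↔ `LFunction ℓ`: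
`QuarticTwistHeckeCharacterDatum` ll. 290–300 (`natCard_point_eq_one_add_card`). -/
theorem anchorTwist_trace_onto (ℓ : ℕ) [Fact ℓ.Prime] (hℓ4 : ℓ % 4 = 1) (hℓ5 : ℓ ≠ 5)
    (x y : ZMod 5) (hxy : x * y = (ℓ : ZMod 5)) :
    ∃ D : ZMod ℓ, D ≠ 0 ∧ (anchorTwist D).IsElliptic ∧ (trace ℓ (anchorTwist D) : ZMod 5) = x + y := by
  sorry

/-- **B4 (S/M) — the `3`-adic unit.**  For a prime `ℓ ≡ 5 (mod 12)` and `D ∈ 𝔽_ℓ^×`: `3 ∤ a_ℓ(E_D)`.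
Two proofs: (a) via B3's formula: `a ∈ {±2a₀, ±2b₀}`, `a₀² + b₀² = ℓ ≡ 2 (3)` forces `3 ∤ a₀b₀`;
(b) the elementary "[i]-lemma": `(x,y) ↦ (−x, ιy)` (`ι² = −1 ∈ 𝔽_ℓ`) is an `𝔽_ℓ`-rational automorphism
of order `4` without eigenvalue `±1` on `E_D[3]`, so one rational point of order `3` gives all of `E_D[3]`
rational, hence `μ₃ ⊆ 𝔽_ℓ^×` (Weil pairing, tree `weilPairingFun_pow`/surjectivity), contradicting
`ℓ ≡ 2 (3)`; therefore `3 ∤ #E_D(𝔽_ℓ) = ℓ + 1 − a ≡ −a (mod 3)`. -/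
theorem anchorTwist_trace_not_three_dvd (ℓ : ℕ) [Fact ℓ.Prime] (hℓ : ℓ % 12 = 5)
    (D : ZMod ℓ) (hD : D ≠ 0) : ¬ (3 : ℤ) ∣ trace ℓ (anchorTwist D) := by
  sorry

/-- **B5 (M) — trace criterion for a direct `5`-congruence over `𝔽_ℓ`** (supersedes gen-3 L3
`directCongrFive_of_trace_modEq`, which is the case `ℓ ≡ 2, 3 (mod 5)` via `disc_ne_zero_mod5`; serves
roads A, B, C at once).  Two elliptic curves over `𝔽_ℓ` (`ℓ ≠ 5`) with the same trace mod `5` whose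
common Frobenius polynomial `X² − āX + ℓ̄ ∈ 𝔽₅[X]` is SEPARABLE are directly `5`-congruent: cyclic
`𝔽₅[φ]`-modules with the same separable characteristic polynomial are isomorphic; the centraliser torus
has surjective determinant onto `𝔽₅^×`, so the isomorphism can be rescaled to match `e₅`
(`weilPairingFun_smul`: `e₅(φP, φQ) = e₅(P,Q)^ℓ` on both sides); `Γ_{𝔽_ℓ}`-equivariance from
`φ`-equivariance (`exists_frobenius_absoluteGaloisGroup`, `frobenius_absoluteGaloisGroup_unique`: the
image of `Γ_{𝔽_ℓ}` in `Aut E[5]` is generated by Frobenius).  Leans on PROVED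
`trace_galoisRepTate_frobenius_holds`, `det_galoisRepTate_frobenius_holds`,
`trace_galoisRepTorsion_eq_toZMod_trace_galoisRepTate`, `galoisRepTate_frobenius_sq_sub_smul_add_smul_eq_zero`,
`finrank_zmod_geomTorsion_eq_two`; Mathlib `Matrix.charpoly`, `LinearMap.trace/det`. -/
theorem directCongrFive_of_trace_eq_of_separable (ℓ : ℕ) [Fact ℓ.Prime]
    (h5 : ((5 : ℕ) : ZMod ℓ) ≠ 0) (V V' : WeierstrassCurve (ZMod ℓ)) [V.IsElliptic] [V'.IsElliptic]
    (htr : (trace ℓ V : ZMod 5) = (trace ℓ V' : ZMod 5))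
    (hsep : (trace ℓ V : ZMod 5) ^ 2 - 4 * (ℓ : ZMod 5) ≠ 0) : DirectCongrFive V V' h5 := by
  sorry

/-- **B6 (S) — invariance of the case predicates under `ℚ`-isomorphism** (to pass to the global minimal
model: `C • W` and `W` have `Γ_ℚ`-equivariantly isomorphic `5`-torsion, tree `VariableChangePoints` /
`Congr`, so equal `tr5`, `det5`). -/
theorem hasSplitSwitchElement_smul_iff (W : WeierstrassCurve ℚ) [W.IsElliptic] (C : VariableChange ℚ) :
    (HasSplitSwitchElement (C • W) ↔ HasSplitSwitchElement W) ∧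
    (HasNonsplitSwitchElement (C • W) ↔ HasNonsplitSwitchElement W) := by
  sorry

/-- **B7 (S) — Case I ⇒ supply** (composition of B2, B3, B4: `(x + y)² − 4xy = (x − y)² ≠ 0`). -/
theorem switchSupplyAt_of_split (W : WeierstrassCurve ℚ) [W.IsElliptic] [W.IsGloballyMinimal]
    (hW : HasSplitSwitchElement W) (S : Finset ℕ) : SwitchSupplyAt W S := by
  obtain ⟨ℓ, hℓ, hℓS, hℓ12, hgood, x, y, hxy, hdet, htr⟩ := frobeniusSupply_split W hW (insert 5 S)
  haveI : Fact ℓ.Prime := ⟨hℓ⟩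
  have hℓ5 : ℓ ≠ 5 := by rintro rfl; simp at hℓS
  obtain ⟨D, hD, hell, hD'⟩ := anchorTwist_trace_onto ℓ (by omega) hℓ5 x y hdet
  refine ⟨ℓ, hℓ, fun h => hℓS (Finset.mem_insert_of_mem h), by omega, hgood, ?_, anchorTwist D, hell,
    by rw [hD', htr], anchorTwist_trace_not_three_dvd ℓ hℓ12 D hD⟩
  rw [← htr, ← hdet]
  have : (x + y) ^ 2 - 4 * (x * y) = (x - y) ^ 2 := by ring
  rw [this]
  exact pow_ne_zero 2 (sub_ne_zero.mpr hxy)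

/-! ## §4 Plan C (the complement class `X₅`): the `j = −3375` anchor, NON-split matching -/

/-- **C2 (L; the hardest new item) — covering lemma.**  Under the stub's `hirr`, every `W` is Case I
or Case II′.  Content: (a) the `GL₂(𝔽₅)` census of `bc/sigma_exist_gl25.py` (Case I fails only for
`G = N(C_ns(5))` with `i`-kernel `C_ns` or `C_ns² ∪ (N ∖ C_ns)_{det ∉ □}`, i.e. Cartan field `ℚ(i)` or
`ℚ(√−5)`); (b) for those `W` the joint image of `Γ_ℚ` on `W[5] × anchor49[5]` (both `N(C_ns(5))`,
`det`-compatible, Cartan fields `≠ ℚ(√−7)`) always contains the required pair (`bc/goursat_planC.py`: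
6 joint-image types, 0 failures) and `√−3 ∉ ℚ(W[5], anchor49[5], √−7)` (quadratic subfields `ℚ(√d)`,
`d ∈ ⟨5, −1, −7⟩ ∌ −3 mod squares`).  Needs the mod-5 image of 49a1 `= N(C_ns(5))` (`⊇`: `Frob₂₃` has
order `24` since `a₂₃ = 8`, via `trace/det_galoisRepTorsion_frobenius_eq`, plus complex conjugation;
`⊆`: the `ℚ(√−7)`-rational CM endomorphism, tree `ComplexMultiplication*`).  Pattern for the finite
group theory: `FLSResidualImageCriteriaProofs` (`GL₂(𝔽₇)`, `decide`-style). -/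
theorem split_or_nonsplit (W : WeierstrassCurve ℚ) [W.IsElliptic]
    (hirr : ∀ ρ : ModPGaloisRep ℚ (ZMod 5) 2, W.IsTorsionGaloisRep 5 ρ → ρ.IsAbsIrreducibleOverSqrt 5) :
    HasSplitSwitchElement W ∨ HasNonsplitSwitchElement W := by
  sorry

/-- **C3 (M) — Case II′ ⇒ supply.**  Chebotarev as in B2 on `W[5] × anchor49[5] ⊔ {ζ₃^{±1}} ⊔ {±√−7}`
gives a good prime `ℓ ≡ 2 (3)`, split in `ℚ(√−7)`, outside `S ∪ {2,3,5,7}`, with `a_ℓ(W)² − 4ℓ` a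
non-square mod `5` and `a_ℓ(49a1) ≡ ±a_ℓ(W) (mod 5)`; the PROVED tree fact
`Deuring1941_frobeniusTrace_eq_add_conj_holds` (case `j = −3375`, `exists_pi_of_j_eq_neg3375`) writes
`a_ℓ(49a1) = π + π̄`, `4ℓ = t² + 7s²`, and `ℓ ≡ 2 (3)` forces `3 ∤ t = a_ℓ(49a1)`; `V :=` the reduction of
`49a1` or of its quadratic twist by a non-residue (`quadraticTwist`, `frobeniusTrace_quadraticTwist_holds`,
PROVED) fixes the sign. -/
theorem switchSupplyAt_of_nonsplit (W : WeierstrassCurve ℚ) [W.IsElliptic] [W.IsGloballyMinimal]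
    (hW : HasNonsplitSwitchElement W) (S : Finset ℕ) : SwitchSupplyAt W S := by
  sorry

/-! ## §5 The assemblies (statements; the proof of `switch_of_switchSupply` follows
`StubSwitchK1G3.switch_of_deuringRoad` from its Step 3 on, with `S := Finset.range (17 + |c₄³ − c₆²|)`,
`a_ℓ(W) = a(baseF c̄₄ c̄₆)` by `frobeniusTrace_eq_of_smul_eq_shortWeierstrass` (PROVED, BSZ file), B5 in
place of L3, and the supplied `V` in place of Deuring's curve) -/

/-- **A1 (M) — supply ⇒ switch.**  Fisher 13.2 (i)/ℚ (tree named fact) + (ii)/𝔽_ℓ (N2′) + F2 + the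
gen-3 plumbing (`exists_integral_base`, `isElliptic_baseF_zmod`, `isElliptic_memberF_of_zmod`,
`member_reduction`, `isTorsionGaloisRep_of_congr`, `hasGlobalMinimalModel_rat`) + B5 turn a switch supply
for (the minimal model of) every `W` satisfying `hirr` into the switch.  `h27`, `h3small` unused. -/
theorem switch_of_switchSupply (hF : thm132_geomTorsionFive_of_hesseFamily) (hFii : Thm132iiPrimeField)
    (hF2 : FrobeniusCertificate) (hGM : hasGlobalMinimalModel_rat)
    (hsmul : ∀ (X : WeierstrassCurve ℚ) (C : VariableChange ℚ) {n : ℕ} [Fact n.Prime]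
      {ρ : ModPGaloisRep ℚ (ZMod n) 2}, X.IsTorsionGaloisRep n ρ → (C • X).IsTorsionGaloisRep n ρ)
    (hsup : ∀ (W : WeierstrassCurve ℚ) [W.IsElliptic] [W.IsGloballyMinimal],
      (∀ ρ : ModPGaloisRep ℚ (ZMod 5) 2, W.IsTorsionGaloisRep 5 ρ → ρ.IsAbsIrreducibleOverSqrt 5) →
      ∀ S : Finset ℕ, SwitchSupplyAt W S) :
    CDT_three_five_switch := by
  sorry

/-- **A2 (S) — the gen-4 road, assembled:** B2–B7 + C2–C3 ⇒ the supply hypothesis of A1. -/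
theorem switchSupply_of_anchorRoads (W : WeierstrassCurve ℚ) [W.IsElliptic] [W.IsGloballyMinimal]
    (hirr : ∀ ρ : ModPGaloisRep ℚ (ZMod 5) 2, W.IsTorsionGaloisRep 5 ρ → ρ.IsAbsIrreducibleOverSqrt 5)
    (S : Finset ℕ) : SwitchSupplyAt W S := by
  rcases split_or_nonsplit W hirr with h | h
  · exact switchSupplyAt_of_split W h S
  · exact switchSupplyAt_of_nonsplit W h S

/-- **The CM-anchor road (gen 4):** named facts Fisher (i)/ℚ, Fisher (ii)/𝔽_ℓ, atom F2, and the
tree's minimal-model facts ⇒ `CDT_three_five_switch` (`= stub_switch` by `Iff.rfl`).  NO Deuring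
existence theorem, NO CM main theorem, NO Hilbert irreducibility. -/
theorem switch_of_anchorRoads (hF : thm132_geomTorsionFive_of_hesseFamily) (hFii : Thm132iiPrimeField)
    (hF2 : FrobeniusCertificate) (hGM : hasGlobalMinimalModel_rat)
    (hsmul : ∀ (X : WeierstrassCurve ℚ) (C : VariableChange ℚ) {n : ℕ} [Fact n.Prime]
      {ρ : ModPGaloisRep ℚ (ZMod n) 2}, X.IsTorsionGaloisRep n ρ → (C • X).IsTorsionGaloisRep n ρ) :
    CDT_three_five_switch :=
  switch_of_switchSupply hF hFii hF2 hGM hsmul (fun W _ _ hirr S => switchSupply_of_anchorRoads W hirr S)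

/-- … and the gen-3 Deuring road is the instance "supply from N1" (uniform, conditional on the XL fact). -/
theorem switchSupplyAt_of_deuring (hDeu : DeuringOrdinaryExistence) (W : WeierstrassCurve ℚ)
    [W.IsElliptic] [W.IsGloballyMinimal] (S : Finset ℕ) : SwitchSupplyAt W S := by
  sorry

end

end Summit.ABC.ABC.Cruxes.FreyModularity.StubSwitchK1G4
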